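import Summits.AtomisticToContinuum.BoseEinsteinCondensation.Theorems.BECThomsonPrincipleGDTransferDefs
import Summits.AtomisticToContinuum.BoseEinsteinCondensation.Theorems.BECGroundStateSOSIRModeCounting

/-!
# Route `BECThomsonPrinciple`, crux `GDTransfer` (stmt-AtomisticToContinuum-9482), line `dyson-dressed-witness`:
# stub `stub_windowLaw` — per-mode solve of the KLS quadratic inequality and the `ℤ³` window count

The elementary step `TwoSidedDualNorm → DressedWitnessFamilyFor v → WindowBoundFor v` of the line (all three
statements in `Theorems.BECThomsonPrincipleGDTransferDefs`).  At `(v, M)` the two hypotheses give constants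
`ρ₀, C, N₀` and `ρ₁, c₁, c₂, γ, N₁`; at `(N, L) = (m+1, L)` with `E₀ < ∞` the family gives a radius `R` and a
slack `δ_B`, the dual norm (tolerance `η = 1`, radius `R`) a slack `δ_A`; with `δ = min δ_A δ_B` every
`δ`-near-minimiser `Ψ` has a defect budget `d` (`Σ_window d ≤ γ√ρN`) and per window mode `n` directions
`ζ±` with, writing `W = ‖ζ₊‖² + ‖ζ₋‖²`, `X = N|σ(ζ₊,Ψ) + σ(Ψ,ζ₋)|`, `g = 2CL²/‖n‖²`, `B = c₁k² + c₂ρ`: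
* dual norm: `X² + gE₀W ≤ g(𝓔(ζ₊) + 𝓔(ζ₋)) + 1`; (W2) `𝓔(ζ₊) + 𝓔(ζ₋) ≤ E₀W + B(1 + W)`;
  (W3) `W ≤ 2X + d(n)`; (W4) `n_n ≤ 2‖ζ₋‖² + d(n)`.
Cancelling the finite `gE₀W` (`occ_le_of_mode`) gives `X² ≤ gB(1 + W) + 1`, and the real algebra
`real_perMode` gives `W ≤ 10gB + 3 + 2d`, so `n_n ≤ 20gB + 6 + 5d(n)` with
`20gB + 6 = 160π²Cc₁ + 6 + 40Cc₂ρL²/‖n‖_∞²`.  Summing over the window (`windowSum_le_of_pointwise`): the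
window `0 < 2π‖n‖_∞/L ≤ M√ρ` lies in the punctured cube of radius `⌊J⌋₊`, `J = M√ρL/(2π)`, which has
`≤ 26J³` points (`card_latticeShell_le`) and `Σ ‖n‖_∞⁻² ≤ 26J` (`sum_inv_norm_sq_latticeShell_le`, shells
of `24j² + 2` points); with `ρL³ = N`, `J³ = M³√ρN/(8π³)` and `ρL²J = M√ρN/(2π)`, so the window carries at
most `K√ρN` particles, `K = 26(160π²Cc₁ + 6)M³/(8π³) + 26·40Cc₂M/(2π) + 5γ`.

References: KennedyLiebShastry1988 (J. Stat. Phys. 53, 1019: the `T = 0` infrared bound per mode);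
LSSY2005 §1.2.
-/

noncomputable section

open MeasureTheory Filter
open scoped ENNReal NNReal

namespace Summit.AtomisticToContinuum.BoseEinsteinCondensation.Cruxes.GDTransfer.DysonDressedWitness

open Literature.MathematicalPhysics.QuantumManyBody.BoseGas
open Summit.AtomisticToContinuum.BoseEinsteinCondensation.Theorems.GaussianDominationCan.Negative
  (InWindow one_le_norm_intVec)
open Summit.AtomisticToContinuum.BoseEinsteinCondensation.Theorems.ModeCounting
  (mem_latticeBox card_latticeBox latticeBox_mono zero_mem_latticeBox eq_zero_of_mem_latticeBox_zero
    succ_le_norm_of_not_mem_latticeBox mem_latticeBox_floor_of_norm_le)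

/-! ## §1 Per-mode algebra -/

/-- **Per-mode real algebra.**  If `X² ≤ A(1 + W) + 1` and `W ≤ 2X + d` with `A, d ≥ 0`, then
`W ≤ 10A + 3 + 2d` (with `u = W - d`: `u² ≤ 4A(1 + u + d) + 4` forces `u ≤ 10A + 3 + d`). [folklore] -/
theorem real_perMode {X A W d : ℝ} (hA : 0 ≤ A) (hd : 0 ≤ d)
    (h1 : X ^ 2 ≤ A * (1 + W) + 1) (h2 : W ≤ 2 * X + d) : W ≤ 10 * A + 3 + 2 * d := by
  by_contra h
  push Not at h
  have hu : 10 * A + 3 + d < W - d := by linarith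
  have h0 : 0 ≤ W - d := by linarith
  have hu2 : (W - d) ^ 2 ≤ 4 * (A * (1 + W) + 1) := by
    have h3 : W - d ≤ 2 * X := by linarith
    calc (W - d) ^ 2 ≤ (2 * X) ^ 2 := by gcongr
      _ = 4 * X ^ 2 := by ring
      _ ≤ 4 * (A * (1 + W) + 1) := by linarith
  have p1 : (10 * A + 3 + d) * (W - d) ≤ (W - d) * (W - d) :=
    mul_le_mul_of_nonneg_right hu.le h0
  have p2 : A * 3 ≤ A * (W - d) := mul_le_mul_of_nonneg_left (by linarith) hA
  have p3 : d * (10 * A + 3 + d) ≤ d * (W - d) := mul_le_mul_of_nonneg_left hu.le hd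
  nlinarith [p1, p2, p3, mul_nonneg hA hd, sq_nonneg d]

/-- **Per-mode solve in `ℝ≥0∞`.**  The two-sided dual-norm bound (`hdual`, tolerance `1`), the second
variation (W2), the response (W3) and `n_n ≤ 2‖ζ₋‖² + d ≤ 2W + d` (W4) give `n_n ≤ 20·gB + 6 + 5d`, after
the finite common term `g·E₀·W` is cancelled (`E₀, W < ∞`) and the real algebra `real_perMode`.
[folklore] -/
theorem occ_le_of_mode {X g B : ℝ} {E W esum dn occ : ℝ≥0∞} (hX : 0 ≤ X) (hg : 0 ≤ g) (hB : 0 ≤ B)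
    (hE : E ≠ ⊤) (hW : W ≠ ⊤) (hdn : dn ≠ ⊤)
    (hdual : ENNReal.ofReal (X ^ 2) + ENNReal.ofReal g * E * W ≤
      ENNReal.ofReal g * esum + ENNReal.ofReal 1)
    (hW2 : esum ≤ E * W + ENNReal.ofReal (B * (1 + W.toReal)))
    (hW3 : W ≤ 2 * ENNReal.ofReal X + dn)
    (hW4 : occ ≤ 2 * W + dn) :
    occ ≤ ENNReal.ofReal (20 * (g * B) + 6) + 5 * dn := by
  obtain ⟨Wr, hWr0, rfl⟩ : ∃ r : ℝ, 0 ≤ r ∧ W = ENNReal.ofReal r :=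
    ⟨W.toReal, ENNReal.toReal_nonneg, (ENNReal.ofReal_toReal hW).symm⟩
  obtain ⟨dr, hdr0, rfl⟩ : ∃ r : ℝ, 0 ≤ r ∧ dn = ENNReal.ofReal r :=
    ⟨dn.toReal, ENNReal.toReal_nonneg, (ENNReal.ofReal_toReal hdn).symm⟩
  rw [ENNReal.toReal_ofReal hWr0] at hW2
  -- (1) cancel the finite common term `g E W`
  have hfin : ENNReal.ofReal g * E * ENNReal.ofReal Wr ≠ ⊤ :=
    ENNReal.mul_ne_top (ENNReal.mul_ne_top ENNReal.ofReal_ne_top hE) ENNReal.ofReal_ne_top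
  have h1 : ENNReal.ofReal (X ^ 2) ≤ ENNReal.ofReal (g * (B * (1 + Wr)) + 1) := by
    rw [ENNReal.ofReal_add (by positivity) zero_le_one, ENNReal.ofReal_mul hg]
    refine ENNReal.le_of_add_le_add_left hfin ?_
    calc ENNReal.ofReal g * E * ENNReal.ofReal Wr + ENNReal.ofReal (X ^ 2)
        = ENNReal.ofReal (X ^ 2) + ENNReal.ofReal g * E * ENNReal.ofReal Wr := add_comm _ _
      _ ≤ ENNReal.ofReal g * esum + ENNReal.ofReal 1 := hdual
      _ ≤ ENNReal.ofReal g * (E * ENNReal.ofReal Wr + ENNReal.ofReal (B * (1 + Wr))) +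
            ENNReal.ofReal 1 := by gcongr
      _ = ENNReal.ofReal g * E * ENNReal.ofReal Wr +
            (ENNReal.ofReal g * ENNReal.ofReal (B * (1 + Wr)) + ENNReal.ofReal 1) := by ring
  have h1r : X ^ 2 ≤ g * B * (1 + Wr) + 1 := by
    have h := (ENNReal.ofReal_le_ofReal_iff (by positivity)).1 h1
    linarith [h, mul_assoc g B (1 + Wr)]
  -- (2) the response bound in `ℝ`
  have h2r : Wr ≤ 2 * X + dr := by
    refine (ENNReal.ofReal_le_ofReal_iff (by positivity)).1 (hW3.trans_eq ?_)
    rw [ENNReal.ofReal_add (by positivity) hdr0, ENNReal.ofReal_mul zero_le_two,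
      ENNReal.ofReal_ofNat]
  -- (3) the real algebra
  have h3r : Wr ≤ 10 * (g * B) + 3 + 2 * dr :=
    real_perMode (mul_nonneg hg hB) hdr0 (by linarith [h1r]) h2r
  -- (4) back to `ℝ≥0∞`
  calc occ ≤ 2 * ENNReal.ofReal Wr + ENNReal.ofReal dr := hW4
    _ ≤ 2 * ENNReal.ofReal (10 * (g * B) + 3 + 2 * dr) + ENNReal.ofReal dr := by gcongr
    _ = ENNReal.ofReal (20 * (g * B) + 6) + ENNReal.ofReal (5 * dr) := by
        rw [← ENNReal.ofReal_ofNat 2, ← ENNReal.ofReal_mul zero_le_two,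
          ← ENNReal.ofReal_add (by positivity) hdr0,
          ← ENNReal.ofReal_add (by positivity) (by positivity)]
        congr 1
        ring
    _ = ENNReal.ofReal (20 * (g * B) + 6) + 5 * ENNReal.ofReal dr := by
        rw [ENNReal.ofReal_mul (by norm_num), ENNReal.ofReal_ofNat]

/-! ## §2 The `ℤ³` window counts

The cube `{-M, …, M}³ ⊂ ℤ³` is the `Finset` `Fintype.piFinset fun _ : Fin 3 => Finset.Icc (-M) M` of
`Theorems.ModeCounting` (whose membership, cardinality and floor lemmas are reused); `‖k‖_∞` is the sup
norm of `k ∈ ℤ³` as a real vector. -/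

/-- `#({-M,…,M}³ ∖ 0) = (2M+1)³ - 1 ≤ 26 M³`. [folklore] -/
theorem card_latticeShell_le (M : ℕ) :
    (((((Fintype.piFinset fun _ : Fin 3 => Finset.Icc (-((M : ℕ) : ℤ)) ((M : ℕ) : ℤ))).erase
      0).card : ℕ) : ℝ) ≤ 26 * (M : ℝ) ^ 3 := by
  have h : (((Fintype.piFinset fun _ : Fin 3 => Finset.Icc (-((M : ℕ) : ℤ)) ((M : ℕ) : ℤ))).erase
      0).card + 1 = (2 * M + 1) ^ 3 := by
    rw [Finset.card_erase_add_one (zero_mem_latticeBox M), card_latticeBox]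
  have h' : (((((Fintype.piFinset fun _ : Fin 3 => Finset.Icc (-((M : ℕ) : ℤ)) ((M : ℕ) : ℤ))).erase
      0).card : ℕ) : ℝ) + 1 = (2 * (M : ℝ) + 1) ^ 3 := by
    exact_mod_cast h
  rcases Nat.eq_zero_or_pos M with hM | hM
  · subst hM
    have h0 : (((((Fintype.piFinset fun _ : Fin 3 => Finset.Icc (-((0 : ℕ) : ℤ)) ((0 : ℕ) : ℤ))).erase
        0).card : ℕ) : ℝ) = 0 := by
      have h1 : (((((Fintype.piFinset fun _ : Fin 3 =>
          Finset.Icc (-((0 : ℕ) : ℤ)) ((0 : ℕ) : ℤ))).erase 0).card : ℕ) : ℝ) + 1 = 1 := by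
        rw [h']
        norm_num
      linarith
    rw [h0]
    norm_num
  · have h1 : (1 : ℝ) ≤ M := by exact_mod_cast hM
    nlinarith [h1, mul_le_mul_of_nonneg_left h1 (sq_nonneg (M : ℝ)),
      mul_le_mul_of_nonneg_left (mul_le_mul h1 h1 zero_le_one (zero_le_one.trans h1))
        (zero_le_one.trans h1)]

/-- **The inverse-square shell sum** `∑_{0 < ‖k‖_∞ ≤ M} 1/‖k‖_∞² ≤ 26 M` on `ℤ³` (the shell `‖k‖_∞ = j`
has `24j² + 2 ≤ 26j²` points; induction on `M`). [folklore] -/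
theorem sum_inv_norm_sq_latticeShell_le (M : ℕ) :
    ∑ k ∈ ((Fintype.piFinset fun _ : Fin 3 => Finset.Icc (-((M : ℕ) : ℤ)) ((M : ℕ) : ℤ))).erase 0,
        1 / ‖(fun i : Fin 3 => ((k i : ℤ) : ℝ))‖ ^ 2 ≤ 26 * (M : ℝ) := by
  classical
  induction M with
  | zero =>
    rw [Finset.sum_eq_zero fun k hk => ?_]
    · simp
    · rw [Finset.mem_erase] at hk
      exact absurd (eq_zero_of_mem_latticeBox_zero hk.2) hk.1
  | succ M ih =>
    set s : Finset (Fin 3 → ℤ) :=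
      ((Fintype.piFinset fun _ : Fin 3 => Finset.Icc (-((M : ℕ) : ℤ)) ((M : ℕ) : ℤ))).erase 0 with hs
    set t : Finset (Fin 3 → ℤ) :=
      ((Fintype.piFinset fun _ : Fin 3 => Finset.Icc (-((M + 1 : ℕ) : ℤ)) ((M + 1 : ℕ) : ℤ))).erase 0
      with ht
    have hsub : s ⊆ t := Finset.erase_subset_erase 0 (latticeBox_mono (Nat.le_succ M))
    rw [← Finset.sum_sdiff hsub]
    -- the new shell: each term is `≤ 1/(M+1)²` and there are `(2M+3)³ - (2M+1)³ = 24(M+1)² + 2` of them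
    have hterm : ∀ k ∈ t \ s,
        1 / ‖(fun i : Fin 3 => ((k i : ℤ) : ℝ))‖ ^ 2 ≤ 1 / ((M : ℝ) + 1) ^ 2 := by
      intro k hk
      have hk' : k ∉ (Fintype.piFinset fun _ : Fin 3 => Finset.Icc (-((M : ℕ) : ℤ)) ((M : ℕ) : ℤ)) := by
        simp only [Finset.mem_sdiff, ht, hs, Finset.mem_erase] at hk
        exact fun h => hk.2 ⟨hk.1.1, h⟩
      have hle := succ_le_norm_of_not_mem_latticeBox hk'
      have hsq : ((M : ℝ) + 1) ^ 2 ≤ ‖(fun i : Fin 3 => ((k i : ℤ) : ℝ))‖ ^ 2 := by gcongr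
      exact one_div_le_one_div_of_le (by positivity) hsq
    have hcard : (((t \ s).card : ℕ) : ℝ) = (2 * ((M : ℝ) + 1) + 1) ^ 3 - (2 * M + 1) ^ 3 := by
      have h1 := Finset.card_sdiff_add_card_eq_card hsub
      have h2 : s.card + 1 = (2 * M + 1) ^ 3 := by
        rw [hs, Finset.card_erase_add_one (zero_mem_latticeBox M), card_latticeBox]
      have h3 : t.card + 1 = (2 * (M + 1) + 1) ^ 3 := by
        rw [ht, Finset.card_erase_add_one (zero_mem_latticeBox (M + 1)), card_latticeBox]
      have h4 : (t \ s).card + (2 * M + 1) ^ 3 = (2 * (M + 1) + 1) ^ 3 := by omega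
      have h5 : (((t \ s).card : ℕ) : ℝ) + (2 * M + 1) ^ 3 = (2 * ((M : ℝ) + 1) + 1) ^ 3 := by
        exact_mod_cast h4
      linarith
    have hshell : ∑ k ∈ t \ s, 1 / ‖(fun i : Fin 3 => ((k i : ℤ) : ℝ))‖ ^ 2 ≤ 26 := by
      calc ∑ k ∈ t \ s, 1 / ‖(fun i : Fin 3 => ((k i : ℤ) : ℝ))‖ ^ 2
          ≤ ∑ _k ∈ t \ s, 1 / ((M : ℝ) + 1) ^ 2 := Finset.sum_le_sum hterm
        _ = ((2 * ((M : ℝ) + 1) + 1) ^ 3 - (2 * M + 1) ^ 3) * (1 / ((M : ℝ) + 1) ^ 2) := by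
            rw [Finset.sum_const, nsmul_eq_mul, hcard]
        _ = (24 * ((M : ℝ) + 1) ^ 2 + 2) / ((M : ℝ) + 1) ^ 2 := by ring
        _ ≤ 26 := by
            rw [div_le_iff₀ (by positivity)]
            nlinarith [sq_nonneg (M : ℝ)]
    push_cast
    linarith [hshell, ih]

/-! ## §3 Summing a per-mode bound over the window -/

/-- A window mode's budget is bounded by the window sum of the budget. -/
theorem le_windowSum {M : ℝ} {m : ℕ} {L : ℝ} (d : (Fin 3 → ℤ) → ℝ≥0∞) {p : Fin 3 → ℤ}
    (hp : p ≠ 0) (hw : InWindow M m L p) : d p ≤ windowSum M m L d := by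
  unfold windowSum
  calc d p = {q : Fin 3 → ℤ | q ≠ 0 ∧ InWindow M m L q}.indicator d p :=
        (Set.indicator_of_mem (show p ∈ {q : Fin 3 → ℤ | q ≠ 0 ∧ InWindow M m L q} from ⟨hp, hw⟩)
          d).symm
    _ ≤ ∑' q, {q : Fin 3 → ℤ | q ≠ 0 ∧ InWindow M m L q}.indicator d q := ENNReal.le_tsum p

/-- A window mode has sup norm at most the window radius `J = M√ρ L/(2π)`. -/
theorem norm_le_of_inWindow {M : ℝ} {m : ℕ} {L : ℝ} (hL : 0 < L) {p : Fin 3 → ℤ}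
    (hw : InWindow M m L p) :
    ‖(fun j => (p j : ℝ))‖ ≤ M * Real.sqrt (((m + 1 : ℕ) : ℝ) / L ^ 3) * L / (2 * Real.pi) := by
  have hw' : 2 * Real.pi * ‖(fun j => (p j : ℝ))‖ / L ≤ M * Real.sqrt (((m + 1 : ℕ) : ℝ) / L ^ 3) :=
    hw
  rw [div_le_iff₀ hL] at hw'
  rw [le_div_iff₀ (by positivity)]
  linarith

/-- **Window sum of a per-mode bound.**  If every window mode `n` obeys `f n ≤ a + b/‖n‖_∞² + 5 d n`, then
`Σ_window f ≤ 26 a J³ + 26 b J + 5 Σ_window d` with `J = M√ρ L/(2π)`: the window lies in the punctured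
cube of radius `⌊J⌋₊`, which has `≤ 26 J³` points (`card_latticeShell_le`) and inverse-square sum `≤ 26 J`
(`sum_inv_norm_sq_latticeShell_le`). [folklore] -/
theorem windowSum_le_of_pointwise {M : ℝ} {m : ℕ} {L : ℝ} (hL : 0 < L) (hM : 0 ≤ M)
    {a b : ℝ} (ha : 0 ≤ a) (hb : 0 ≤ b) {f d : (Fin 3 → ℤ) → ℝ≥0∞}
    (hf : ∀ n : Fin 3 → ℤ, n ≠ 0 → InWindow M m L n →
      f n ≤ ENNReal.ofReal (a + b / ‖(fun j => (n j : ℝ))‖ ^ 2) + 5 * d n) :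
    windowSum M m L f ≤
      ENNReal.ofReal (26 * a * (M * Real.sqrt (((m + 1 : ℕ) : ℝ) / L ^ 3) * L / (2 * Real.pi)) ^ 3 +
          26 * b * (M * Real.sqrt (((m + 1 : ℕ) : ℝ) / L ^ 3) * L / (2 * Real.pi))) +
        5 * windowSum M m L d := by
  classical
  set J : ℝ := M * Real.sqrt (((m + 1 : ℕ) : ℝ) / L ^ 3) * L / (2 * Real.pi) with hJ
  have hJ0 : 0 ≤ J := by positivity
  set S : Set (Fin 3 → ℤ) := {p | p ≠ 0 ∧ InWindow M m L p} with hS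
  set F : Finset (Fin 3 → ℤ) :=
    ((Fintype.piFinset fun _ : Fin 3 => Finset.Icc (-((⌊J⌋₊ : ℕ) : ℤ)) ((⌊J⌋₊ : ℕ) : ℤ))).erase 0
    with hF
  set g : (Fin 3 → ℤ) → ℝ := fun p => a + b / ‖(fun i : Fin 3 => ((p i : ℤ) : ℝ))‖ ^ 2 with hg
  have hg0 : ∀ p, 0 ≤ g p := fun p => by positivity
  -- the window lies in the punctured cube of radius `⌊J⌋₊`
  have hSF : ∀ p ∈ S, p ∈ F := by
    rintro p ⟨hp0, hpw⟩
    exact Finset.mem_erase.2 ⟨hp0, mem_latticeBox_floor_of_norm_le (norm_le_of_inWindow hL hpw)⟩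
  have hpt : ∀ p, S.indicator f p ≤
      (F : Set (Fin 3 → ℤ)).indicator (fun p => ENNReal.ofReal (g p)) p + 5 * S.indicator d p := by
    intro p
    by_cases hp : p ∈ S
    · rw [Set.indicator_of_mem hp, Set.indicator_of_mem hp, Set.indicator_of_mem (hSF p hp)]
      exact hf p hp.1 hp.2
    · rw [Set.indicator_of_notMem hp]
      exact zero_le
  -- the two lattice counts
  have hreal : ∑ p ∈ F, g p ≤ 26 * a * J ^ 3 + 26 * b * J := by
    have hfl : (⌊J⌋₊ : ℝ) ≤ J := Nat.floor_le hJ0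
    calc ∑ p ∈ F, g p
        = (F.card : ℝ) * a + b * ∑ p ∈ F, 1 / ‖(fun i : Fin 3 => ((p i : ℤ) : ℝ))‖ ^ 2 := by
          rw [hg, Finset.sum_add_distrib, Finset.sum_const, nsmul_eq_mul, Finset.mul_sum]
          congr 1
          refine Finset.sum_congr rfl fun p _ => ?_
          ring
      _ ≤ 26 * (⌊J⌋₊ : ℝ) ^ 3 * a + b * (26 * (⌊J⌋₊ : ℝ)) := by
          gcongr
          · exact card_latticeShell_le _
          · exact sum_inv_norm_sq_latticeShell_le _
      _ ≤ 26 * J ^ 3 * a + b * (26 * J) := by gcongr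
      _ = 26 * a * J ^ 3 + 26 * b * J := by ring
  calc windowSum M m L f = ∑' p, S.indicator f p := rfl
    _ ≤ ∑' p, ((F : Set (Fin 3 → ℤ)).indicator (fun p => ENNReal.ofReal (g p)) p +
          5 * S.indicator d p) := ENNReal.tsum_le_tsum hpt
    _ = ENNReal.ofReal (∑ p ∈ F, g p) + 5 * windowSum M m L d := by
        rw [ENNReal.tsum_add, ENNReal.tsum_mul_left, ENNReal.ofReal_sum_of_nonneg fun p _ => hg0 p,
          sum_eq_tsum_indicator]
        rfl
    _ ≤ ENNReal.ofReal (26 * a * J ^ 3 + 26 * b * J) + 5 * windowSum M m L d := by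
        gcongr

/-! ## §4 The registered stub -/

/-- **Registered stub `stub_windowLaw`** (line `dyson-dressed-witness` of crux `GDTransfer`,
stmt-AtomisticToContinuum-9482): `TwoSidedDualNorm → DressedWitnessFamilyFor v → WindowBoundFor v`.
Constants at `(v, M)`: `ρ₁ := min ρ₀ ρ₁`, `N₁ := max N₀ N₁`,
`K := 26(160π²Cc₁ + 6)M³/(8π³) + 26·40Cc₂M/(2π) + 5γ`; at `(m, L)`: `R, δ_B` from the family, `δ_A` from the
dual norm at tolerance `η = 1` and radius `R`, `δ := min δ_A δ_B`.  Per window mode `occ_le_of_mode` gives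
`n_n ≤ 160π²Cc₁ + 6 + 40Cc₂ρL²/‖n‖_∞² + 5d(n)`; `windowSum_le_of_pointwise` sums it with `J³ = M³√ρN/(8π³)`,
`ρL²J = M√ρN/(2π)` (`ρL³ = N`). [cite: KennedyLiebShastry1988, the `T = 0` infrared bound] -/
theorem stub_windowLaw : Sig.stub_windowLaw := by
  intro hT v hv hD M hM
  obtain ⟨ρ₀, C, hρ₀, hC, N₀, hA⟩ := hT v hv M hM
  obtain ⟨ρ₁, c₁, c₂, γ, hρ₁, hc₁, hc₂, hγ, N₁, hB⟩ := hD M hM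
  -- the constants
  set a : ℝ := 160 * Real.pi ^ 2 * C * c₁ + 6 with ha
  have ha0 : 0 < a := by positivity
  set K : ℝ := 26 * a * M ^ 3 / (8 * Real.pi ^ 3) + 26 * (40 * C * c₂) * M / (2 * Real.pi) + 5 * γ
    with hK
  have hK0 : 0 < K := by positivity
  refine ⟨min ρ₀ ρ₁, K, lt_min hρ₀ hρ₁, hK0, max N₀ N₁, ?_⟩
  intro m hm L hL hmL hE0
  have hm₀ : N₀ ≤ m + 1 := (le_max_left _ _).trans hm
  have hm₁ : N₁ ≤ m + 1 := (le_max_right _ _).trans hm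
  have hL3 : 0 < L ^ 3 := by positivity
  have hmL₀ : ((m + 1 : ℕ) : ℝ) ≤ ρ₀ * L ^ 3 :=
    hmL.trans (mul_le_mul_of_nonneg_right (min_le_left _ _) hL3.le)
  have hmL₁ : ((m + 1 : ℕ) : ℝ) ≤ ρ₁ * L ^ 3 :=
    hmL.trans (mul_le_mul_of_nonneg_right (min_le_right _ _) hL3.le)
  obtain ⟨R, hR, δB, hδB, hBΨ⟩ := hB m hm₁ L hL hmL₁ hE0
  obtain ⟨δA, hδA, hAΨ⟩ := hA m hm₀ L hL hmL₀ hE0 1 R one_pos hR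
  refine ⟨min δA δB, lt_min hδA hδB, fun Ψ hΨ => ?_⟩
  have hΨA : periodicEnergy v Ψ ≤ periodicGroundStateEnergy v (m + 1) L + δA :=
    hΨ.trans (add_le_add le_rfl (min_le_left _ _))
  have hΨB : periodicEnergy v Ψ ≤ periodicGroundStateEnergy v (m + 1) L + δB :=
    hΨ.trans (add_le_add le_rfl (min_le_right _ _))
  obtain ⟨d, hdsum, hmode⟩ := hBΨ Ψ hΨB
  have hdtop : windowSum M m L d ≠ ⊤ := ne_top_of_le_ne_top ENNReal.ofReal_ne_top hdsum
  -- the per-mode bound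
  have hper : ∀ n : Fin 3 → ℤ, n ≠ 0 → InWindow M m L n →
      cellOccupation (m + 1) L (planeWaveMode L n) Ψ.ψ ≤
        ENNReal.ofReal (a + 40 * C * c₂ * (((m + 1 : ℕ) : ℝ) / L ^ 3) * L ^ 2 /
            ‖(fun j => (n j : ℝ))‖ ^ 2) + 5 * d n := by
    intro n hn hwin
    obtain ⟨ζp, ζm, hζp, hζm, hmp, hmm, hep, hem, hW2, hW3, hW4⟩ := hmode n hn hwin
    have hdual := hAΨ Ψ hΨA n hn hwin ζp ζm hζp hζm hmp hmm hep hem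
    have hnpos : 0 < ‖(fun j => (n j : ℝ))‖ := one_pos.trans_le (one_le_norm_intVec hn)
    have hν0 : ‖(fun j => (n j : ℝ))‖ ≠ 0 := hnpos.ne'
    have hL0 : L ≠ 0 := hL.ne'
    have hWtop : mass L ζp + mass L ζm ≠ ⊤ :=
      ne_top_of_le_ne_top (ENNReal.add_ne_top.2 ⟨ENNReal.ofReal_ne_top, ENNReal.ofReal_ne_top⟩)
        (add_le_add hmp hmm)
    have hdn : d n ≠ ⊤ := ne_top_of_le_ne_top hdtop (le_windowSum d hn hwin)
    have hocc := occ_le_of_mode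
      (X := ((m + 1 : ℕ) : ℝ) * ‖srcPair m L n ζp Ψ.ψ + srcPair m L n Ψ.ψ ζm‖)
      (g := 2 * C * L ^ 2 / ‖(fun j => (n j : ℝ))‖ ^ 2)
      (B := c₁ * (2 * Real.pi * ‖(fun j => (n j : ℝ))‖ / L) ^ 2 + c₂ * (((m + 1 : ℕ) : ℝ) / L ^ 3))
      (by positivity) (by positivity) (by positivity) hE0 hWtop hdn hdual hW2 hW3
      (hW4.trans (by gcongr; exact le_add_self))
    have hid : 20 * (2 * C * L ^ 2 / ‖(fun j => (n j : ℝ))‖ ^ 2 *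
          (c₁ * (2 * Real.pi * ‖(fun j => (n j : ℝ))‖ / L) ^ 2 + c₂ * (((m + 1 : ℕ) : ℝ) / L ^ 3))) +
          6 =
        a + 40 * C * c₂ * (((m + 1 : ℕ) : ℝ) / L ^ 3) * L ^ 2 / ‖(fun j => (n j : ℝ))‖ ^ 2 := by
      rw [ha]
      field_simp
      ring
    rw [hid] at hocc
    exact hocc
  -- the window sum of the per-mode bound
  have hb0 : 0 ≤ 40 * C * c₂ * (((m + 1 : ℕ) : ℝ) / L ^ 3) * L ^ 2 := by positivity
  have hsum := windowSum_le_of_pointwise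
    (f := fun p => cellOccupation (m + 1) L (planeWaveMode L p) Ψ.ψ) (d := d) hL hM.le ha0.le hb0 hper
  -- the final algebra: every piece is `const · √ρ · N`
  set N : ℝ := ((m + 1 : ℕ) : ℝ) with hN
  set ρ : ℝ := N / L ^ 3 with hρ
  set s : ℝ := Real.sqrt ρ with hs
  set J : ℝ := M * s * L / (2 * Real.pi) with hJ
  have hNm : N = (m : ℝ) + 1 := Nat.cast_succ m
  have hρ0 : 0 ≤ ρ := by positivity
  have hs0 : 0 ≤ s := Real.sqrt_nonneg _
  have hs2 : s ^ 2 = ρ := Real.sq_sqrt hρ0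
  have hρN : ρ * L ^ 3 = (m : ℝ) + 1 := by
    rw [hρ, hNm]
    field_simp
  have hJ0 : 0 ≤ J := by positivity
  have h26 : 0 ≤ 26 * a * J ^ 3 + 26 * (40 * C * c₂ * ρ * L ^ 2) * J := by positivity
  calc windowSum M m L (fun p => cellOccupation (m + 1) L (planeWaveMode L p) Ψ.ψ)
      ≤ ENNReal.ofReal (26 * a * J ^ 3 + 26 * (40 * C * c₂ * ρ * L ^ 2) * J) +
          5 * windowSum M m L d := hsum
    _ ≤ ENNReal.ofReal (26 * a * J ^ 3 + 26 * (40 * C * c₂ * ρ * L ^ 2) * J) +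
          5 * ENNReal.ofReal (γ * s * (m + 1)) := by gcongr
    _ = ENNReal.ofReal (26 * a * J ^ 3 + 26 * (40 * C * c₂ * ρ * L ^ 2) * J +
          5 * (γ * s * (m + 1))) := by
        rw [← ENNReal.ofReal_ofNat 5, ← ENNReal.ofReal_mul (by norm_num : (0 : ℝ) ≤ 5),
          ← ENNReal.ofReal_add h26 (by positivity)]
    _ = ENNReal.ofReal (K * s * (m + 1)) := by
        congr 1
        rw [hK, hJ]
        linear_combination (26 * a * M ^ 3 * s * L ^ 3 / (8 * Real.pi ^ 3)) * hs2 +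
          (26 * a * M ^ 3 * s / (8 * Real.pi ^ 3) + 26 * (40 * C * c₂) * M * s / (2 * Real.pi)) * hρN

end Summit.AtomisticToContinuum.BoseEinsteinCondensation.Cruxes.GDTransfer.DysonDressedWitness

end
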